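import Mathlib.LinearAlgebra.Eigenspace.Triangularizable
import Literature.Algebra.Lie.LefschetzModuleInvariantForm
import Literature.Algebra.Lie.LefschetzModulePrimitive
import HarnessLib

/-!
# A non-zero invariant form on an irreducible Lefschetz module is non-degenerate, and orthogonal or symplectic (Looijenga–Lunts 1997, §1 (1.3))

Topic `Literature/Algebra/Lie` (namespace `Literature.Algebra.Lie`).  Lane `lit-hodgefound` (Track 2 foundations
library), skeleton seat `lit-hodgefound-skel-1` (generation 43), row **A1-120** of
`run/shared/lean/pub/lit-hodgefound/SKELETON.md`: the first half of the third sentence of Looijenga–Lunts' (1.3) —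
"a nonzero invariant bilinear form on an irreducible representation is either orthogonal or symplectic" — for
Lefschetz modules `(𝔞, M)` (A1-88 `IsLefschetzModule`) irreducible over `𝔤(𝔞, M)`, on top of A1-97
(`LefschetzModuleInvariantForm.lean`: every `x ∈ 𝔤(𝔞, M)` preserves an invariant form, with no non-degeneracy
assumption).  THEOREMS ONLY (no definition, no named fact, no `sorry`; D-0026 net debt `0`).  `LieRing.ofAssociativeRing`
on `𝔤𝔩(M) = Module.End K M` is enabled FILE-LOCALLY as in the rest of the series.

## Source, VERBATIM

E. Looijenga, V. A. Lunts, *A Lie algebra attached to a projective variety*, Invent. Math. **129** (1997) 361–412,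
§1 (1.3) (held TeX text `paper:arxiv-alg-geom_9604014`, p0005 L1–L16):

> "(1.3) Given a Lefschetz module `M` of `𝔞`, then an invariant bilinear form on `M` is a bilinear map
> `φ : M × M → K` that defines a morphism of Lefschetz modules `M ⊗ M → K` (where `𝔞` acts trivially on `K`): so
> `φ` is zero on `M_k × M_l` unless `k + l = 0` and `𝔞` preserves the form `φ` infinitesimally:
> `φ(e_a m, m') + φ(m, e_a m') = 0` for all `m, m' ∈ M` and `a ∈ 𝔞`. If `a` is a Lefschetz element, then the
> Jacobson–Morozov lemma implies that `f_a` also preserves `φ` infinitesimally. So `𝔤(𝔞, M)` is then a subalgebra of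
> `aut(M, φ)`. If `φ` is nondegenerate and symmetric (resp. skew-symmetric), then we call `(M, φ)` an orthogonal
> (resp. symplectic) representation. Since a nonzero invariant bilinear form on an irreducible representation is
> either orthogonal or symplectic, any Lefschetz module with nondegenerate bilinear form is the perpendicular direct
> sum of Lefschetz modules that are irreducible orthogonal, irreducible symplectic, or the direct sum of an
> irreducible Lefschetz module with its dual."

## Rendering (dictionary)

* "invariant bilinear form": a `φ : LinearMap.BilinForm K M` with `φ.IsSkewAdjoint h` (⟺ "`φ` is zero on
  `M_k × M_l` unless `k + l = 0`", A1-91/A1-97 `isSkewAdjoint_of_forall_apply_eq_zero`) and `φ.IsSkewAdjoint a` for all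
  `a ∈ 𝔞`; then every `x ∈ 𝔤(𝔞, M)` is `φ`-skew (A1-97 `isSkewAdjoint_of_mem_lefschetzLieAlgebra'`).
* "irreducible representation": `M ≠ 0` irreducible over `𝔤(𝔞, M)` (Mathlib `LieModule.IsIrreducible`, as in
  A1-103/A1-113).
* "nondegenerate": Mathlib `LinearMap.BilinForm.Nondegenerate` (left- and right-separating).  "symmetric":
  `LinearMap.BilinForm.IsSymm` (`φ = φᵀ`, `φᵀ = LinearMap.flip φ`); "skew-symmetric": `φᵀ = -φ`, equivalently
  (characteristic `0`) alternating, `LinearMap.IsAlt φ`.  "orthogonal (resp. symplectic) representation": non-degenerate and symmetric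
  (resp. skew-symmetric).

## Contents (all proved)

* §1 **non-degeneracy** (any field of characteristic `0`): the left radical `ker φ` and the right radical `ker φᵀ`
  are stable under every `φ`-skew operator (`apply_mem_ker_of_isSkewAdjoint`, `apply_mem_ker_flip_of_isSkewAdjoint`),
  hence `𝔤(𝔞, M)`-stable; for `M` irreducible and `φ ≠ 0` they vanish:
  **`IsLefschetzModule.nondegenerate_of_isIrreducible`**.
* §2 **orthogonal or symplectic** (`K` ALGEBRAICALLY CLOSED — Schur's lemma): the operator `g = φ⁻¹ ∘ φᵀ`
  (`φ(g v, w) = φ(w, v)`) commutes with every `φ`-skew operator (`commute_of_isSkewAdjoint_of_forall_apply`), so an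
  eigenspace of `g` is `𝔤(𝔞, M)`-stable and `g` is a scalar `μ` with `μ² = 1`:
  **`IsLefschetzModule.flip_eq_or_flip_eq_neg_of_isIrreducible`** (`φᵀ = φ` or `φᵀ = -φ`) and
  **`IsLefschetzModule.isSymm_or_isAlt_of_isIrreducible`** ("either orthogonal or symplectic").
* §3 the same with the printed hypothesis "`φ` is zero on `M_k × M_l` unless `k + l = 0`" in place of
  `φ.IsSkewAdjoint h` (`…_of_isIrreducible'`).

## SCOPE (what is NOT formalised here)

(a) The second half of the sentence — "any Lefschetz module with nondegenerate bilinear form is the perpendicular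
direct sum of Lefschetz modules that are irreducible orthogonal, irreducible symplectic, or the direct sum of an
irreducible Lefschetz module with its dual" — is not formalised (the complete-reducibility and orthogonal-complement
tools are in A1-96 `LefschetzModulePolarization.lean` and Mathlib `LieAlgebra.InvariantForm.orthogonal`).
(b) As for (1.15) (A1-118), the dichotomy "orthogonal or symplectic" is Schur's lemma and is formalised for `K`
algebraically closed; the source does not name the field hypothesis, and over `ℚ` the printed sentence fails even for
Lefschetz modules: with `Q = (−1, −1)_ℚ` the Hamilton quaternions over `ℚ` (a division algebra), `M = Q²` (columns;
`dim_ℚ M = 8`), `h = diag(1, −1)` and `𝔞 = {b·E₁₂ : b ∈ Q, b̄ = −b}` (`dim_ℚ 𝔞 = 3`; every `b ≠ 0` gives a Lefschetz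
element of depth `1` with `f = b⁻¹·E₂₁`), the Lie algebra `𝔤(𝔞, M)` is `𝔲(Q², Φ) = {((a, b), (c, −ā)) : a ∈ Q, b̄ = −b, c̄ = −c}`
for the hyperbolic hermitian form `Φ(x, y) = x̄₁ y₂ + x̄₂ y₁` (a `ℚ`-form of `𝔰𝔭₄`, `dim_ℚ = 10`, simple), `M` is
irreducible over it (`𝔤(𝔞, M)` generates the simple algebra `M₂(Q)`, whose simple module is `Q²`), and the invariant
`ℚ`-bilinear forms are the `φ_q(x, y) = trd(q·Φ(x, y))`, `q ∈ Q`, with `φ_qᵀ = φ_{q̄}`: `φ₁` is orthogonal, `φ_i` is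
symplectic, and `φ_{1+i}` is non-degenerate, `h`- and `𝔞`-invariant, but neither symmetric nor alternating (not
formalised).  Non-degeneracy (§1) needs no hypothesis on `K`.  (c) Nothing here concerns complex tori or the Hodge conjecture.

## References

* [LooijengaLunts1997] E. Looijenga, V. A. Lunts, *A Lie algebra attached to a projective variety*, Invent. Math. 129
  (1997) 361–412; arXiv:alg-geom/9604014. §1 (1.3), p. 5 L1–L16 of the held TeX text.
-/

namespace Literature.Algebra.Lie

open Module Function Set LieModule
open LinearMap (BilinForm)

-- The commutator Lie ring of `𝔤𝔩(M) = Module.End K M`: Mathlib's reducible NON-instance, enabled file-locally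
-- exactly as in `LefschetzModule.lean` / `LefschetzModuleInvariantForm.lean`.
attribute [local instance 100] LieRing.ofAssociativeRing

/-! ### §1 The radicals of an invariant form are submodules; non-degeneracy on irreducible modules -/

section Radical

variable {K : Type*} [Field K] {M : Type*} [AddCommGroup M] [Module K M] {B : BilinForm K M}

/-- The LEFT radical `{x | φ(x, ·) = 0}` of a bilinear form is stable under every `φ`-skew operator `u`
(`φ(u x, y) = -φ(x, u y)`). [cite: LooijengaLunts1997, §1 (1.3) p0005 L8–L12 ("𝔤(𝔞, M) is then a subalgebra of aut(M, φ) … nonzero invariant bilinear form on an irreducible representation")] -/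
theorem apply_mem_ker_of_isSkewAdjoint {u : Module.End K M} (hu : B.IsSkewAdjoint u) {x : M}
    (hx : x ∈ LinearMap.ker B) : u x ∈ LinearMap.ker B := by
  rw [LinearMap.mem_ker] at hx ⊢
  ext y
  rw [hu x y, Pi.neg_apply, map_neg, hx, LinearMap.zero_apply, LinearMap.zero_apply, neg_zero]

/-- The RIGHT radical `{y | φ(·, y) = 0}` of a bilinear form is stable under every `φ`-skew operator.
[cite: LooijengaLunts1997, §1 (1.3) p0005 L8–L12] -/
theorem apply_mem_ker_flip_of_isSkewAdjoint {u : Module.End K M} (hu : B.IsSkewAdjoint u) {y : M}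
    (hy : y ∈ LinearMap.ker (LinearMap.flip B)) : u y ∈ LinearMap.ker (LinearMap.flip B) := by
  rw [LinearMap.mem_ker] at hy ⊢
  ext x
  rw [LinearMap.flip_apply, LinearMap.zero_apply]
  have h1 : B (u x) y = -B x (u y) := by rw [hu x y, Pi.neg_apply, map_neg]
  have h2 : LinearMap.flip B y (u x) = 0 := by rw [hy, LinearMap.zero_apply]
  rw [LinearMap.flip_apply] at h2
  rw [h2] at h1
  exact neg_eq_zero.1 h1.symm

variable [CharZero K] [FiniteDimensional K M] {h : Module.End K M} {𝔞 : Submodule K (Module.End K M)}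

/-- **A non-zero invariant bilinear form on an irreducible Lefschetz module is non-degenerate** ("a nonzero invariant
bilinear form on an irreducible representation is either orthogonal or symplectic" — in particular non-degenerate):
its left and right radicals are `𝔤(𝔞, M)`-stable (every `x ∈ 𝔤(𝔞, M)` being `φ`-skew, A1-97) and not all of `M`.
Any field of characteristic `0`. [cite: LooijengaLunts1997, §1 (1.3) p0005 L10–L12] -/
theorem IsLefschetzModule.nondegenerate_of_isIrreducible (_A : IsLefschetzModule K h 𝔞) [Nontrivial M]
    [LieModule.IsIrreducible K (lefschetzLieAlgebra K h 𝔞) M] (hB : B ≠ 0) (hh : B.IsSkewAdjoint h)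
    (h𝔞 : ∀ a ∈ 𝔞, B.IsSkewAdjoint a) : B.Nondegenerate := by
  have hskew : ∀ x ∈ lefschetzLieAlgebra K h 𝔞, B.IsSkewAdjoint x :=
    fun x hx ↦ isSkewAdjoint_of_mem_lefschetzLieAlgebra' hh h𝔞 hx
  have hirr := (isIrreducible_iff_forall_stable (h := h) (𝔞 := 𝔞)).1 ‹_›
  refine ⟨?_, ?_⟩
  · rw [LinearMap.separatingLeft_iff_ker_eq_bot]
    rcases hirr (LinearMap.ker B) (fun x hx v hv ↦ apply_mem_ker_of_isSkewAdjoint (hskew x hx) hv) with h1 | h1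
    · exact h1
    · exact absurd (LinearMap.ker_eq_top.1 h1) hB
  · rw [LinearMap.separatingRight_iff_flip_ker_eq_bot]
    rcases hirr (LinearMap.ker (LinearMap.flip B))
      (fun x hx v hv ↦ apply_mem_ker_flip_of_isSkewAdjoint (hskew x hx) hv) with h1 | h1
    · exact h1
    · exfalso
      apply hB
      have h2 : LinearMap.flip B = 0 := LinearMap.ker_eq_top.1 h1
      ext x y
      have h3 := LinearMap.congr_fun₂ h2 y x
      rw [LinearMap.flip_apply] at h3
      rw [h3, LinearMap.zero_apply, LinearMap.zero_apply, LinearMap.zero_apply, LinearMap.zero_apply]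

/-- The same with the printed hypothesis "`φ` is zero on `M_k × M_l` unless `k + l = 0`" in place of
`φ.IsSkewAdjoint h`. [cite: LooijengaLunts1997, §1 (1.3) p0005 L3–L4, L10–L12] -/
theorem IsLefschetzModule.nondegenerate_of_isIrreducible' (A : IsLefschetzModule K h 𝔞) [Nontrivial M]
    [LieModule.IsIrreducible K (lefschetzLieAlgebra K h 𝔞) M] (hB : B ≠ 0)
    (h0 : ∀ k l : ℤ, k + l ≠ 0 → ∀ x ∈ degreeSpace h k, ∀ y ∈ degreeSpace h l, B x y = 0)
    (h𝔞 : ∀ a ∈ 𝔞, B.IsSkewAdjoint a) : B.Nondegenerate :=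
  A.nondegenerate_of_isIrreducible hB (isSkewAdjoint_of_forall_apply_eq_zero A.isZGrading h0) h𝔞

end Radical

/-! ### §2 "either orthogonal or symplectic" (Schur's lemma, `K` algebraically closed) -/

section Schur

variable {K : Type*} [Field K] {M : Type*} [AddCommGroup M] [Module K M] {B : BilinForm K M}

/-- An operator `g` with `φ(g v, w) = φ(w, v)` (i.e. `g = φ⁻¹ ∘ φᵀ` when `φ` is non-degenerate) commutes with every
`φ`-skew operator `x`, provided `φ` is left-separating: `φ(g(x v) - x(g v), w) = φ(w, x v) + φ(g v, x w) =
-φ(x w, v) + φ(x w, v) = 0`. [cite: LooijengaLunts1997, §1 (1.3) p0005 L10–L12 ("either orthogonal or symplectic")] -/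
theorem commute_of_isSkewAdjoint_of_forall_apply (hsep : B.SeparatingLeft) {g : Module.End K M}
    (hg : ∀ v w, B (g v) w = B w v) {x : Module.End K M} (hx : B.IsSkewAdjoint x) : Commute x g := by
  have hx' : ∀ u v, B (x u) v = -B u (x v) := fun u v ↦ by rw [hx u v, Pi.neg_apply, map_neg]
  ext v
  rw [Module.End.mul_apply, Module.End.mul_apply]
  have h0 : g (x v) - x (g v) = 0 := by
    refine hsep _ fun w ↦ ?_
    have e1 : B w (x v) = -B (x w) v := by rw [hx' w v, neg_neg]
    rw [map_sub, LinearMap.sub_apply, hg, hx' (g v) w, hg, e1, sub_self]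
  exact (sub_eq_zero.1 h0).symm

variable [CharZero K] [FiniteDimensional K M] {h : Module.End K M} {𝔞 : Submodule K (Module.End K M)}

/-- **"a nonzero invariant bilinear form on an irreducible representation is either orthogonal or symplectic":
`φᵀ = φ` or `φᵀ = -φ`** for a non-zero invariant form `φ` on an irreducible Lefschetz module over an ALGEBRAICALLY
CLOSED field of characteristic `0`.  Proof (Schur): `φ` is non-degenerate (§1); the operator `g = φ⁻¹ ∘ φᵀ` (Mathlib
`LinearMap.BilinForm.toDual`) commutes with `𝔤(𝔞, M)`, so any eigenspace of `g` is a non-zero `𝔤(𝔞, M)`-stable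
subspace, whence `g = μ` and `φᵀ = μ φ`; transposing twice, `μ² = 1`. [cite: LooijengaLunts1997, §1 (1.3) p0005 L10–L12] -/
theorem IsLefschetzModule.flip_eq_or_flip_eq_neg_of_isIrreducible [IsAlgClosed K] (A : IsLefschetzModule K h 𝔞)
    [Nontrivial M] [LieModule.IsIrreducible K (lefschetzLieAlgebra K h 𝔞) M] (hB : B ≠ 0) (hh : B.IsSkewAdjoint h)
    (h𝔞 : ∀ a ∈ 𝔞, B.IsSkewAdjoint a) : LinearMap.flip B = B ∨ LinearMap.flip B = -B := by
  have hnd := A.nondegenerate_of_isIrreducible hB hh h𝔞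
  have hskew : ∀ x ∈ lefschetzLieAlgebra K h 𝔞, B.IsSkewAdjoint x :=
    fun x hx ↦ isSkewAdjoint_of_mem_lefschetzLieAlgebra' hh h𝔞 hx
  have hirr := (isIrreducible_iff_forall_stable (h := h) (𝔞 := 𝔞)).1 ‹_›
  -- `g = φ⁻¹ ∘ φᵀ`: `φ(g v, w) = φ(w, v)`
  set g : Module.End K M := (B.toDual hnd).symm.toLinearMap ∘ₗ LinearMap.flip B with hg_def
  have hg : ∀ v w, B (g v) w = B w v := fun v w ↦ by
    rw [hg_def, LinearMap.comp_apply, LinearEquiv.coe_toLinearMap, LinearMap.BilinForm.apply_toDual_symm_apply,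
      LinearMap.flip_apply]
  -- an eigenspace of `g` is `𝔤(𝔞, M)`-stable, hence everything
  obtain ⟨μ, hμ⟩ := Module.End.exists_eigenvalue g
  have hE : ∀ x ∈ lefschetzLieAlgebra K h 𝔞, ∀ v ∈ g.eigenspace μ, x v ∈ g.eigenspace μ := by
    intro x hx v hv
    rw [Module.End.mem_eigenspace_iff] at hv ⊢
    rw [← Module.End.mul_apply, ← (commute_of_isSkewAdjoint_of_forall_apply hnd.1 hg (hskew x hx)).eq,
      Module.End.mul_apply, hv, map_smul]
  have htop : g.eigenspace μ = ⊤ := (hirr _ hE).resolve_left (Module.End.hasEigenvalue_iff.1 hμ)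
  have hgμ : ∀ v, g v = μ • v := fun v ↦
    Module.End.mem_eigenspace_iff.1 (htop ▸ Submodule.mem_top : v ∈ g.eigenspace μ)
  -- `φᵀ = μ φ` and `μ² = 1`
  have hf : ∀ v w, B w v = μ * B v w := fun v w ↦ by
    rw [← hg v w, hgμ v, map_smul, LinearMap.smul_apply, smul_eq_mul]
  obtain ⟨x, y, hxy⟩ : ∃ x y, B x y ≠ 0 := by
    by_contra hno
    push Not at hno
    exact hB (LinearMap.ext₂ fun x y ↦ by rw [hno x y, LinearMap.zero_apply, LinearMap.zero_apply])
  have h1 : B x y = μ * (μ * B x y) := by rw [← hf x y, ← hf y x]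
  have h2 : (μ * μ - 1) * B x y = 0 := by linear_combination -h1
  have hμ1 : μ * μ = 1 := by
    rcases mul_eq_zero.1 h2 with h3 | h3
    · exact sub_eq_zero.1 h3
    · exact absurd h3 hxy
  rcases mul_self_eq_one_iff.1 hμ1 with rfl | rfl
  · left
    ext v w
    rw [LinearMap.flip_apply, hf v w, one_mul]
  · right
    ext v w
    rw [LinearMap.flip_apply, hf v w, LinearMap.neg_apply, LinearMap.neg_apply, neg_one_mul]

/-- **"either orthogonal or symplectic"**: a non-zero invariant bilinear form on an irreducible Lefschetz module
over an algebraically closed field of characteristic `0` is non-degenerate and either symmetric (`(M, φ)` is an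
orthogonal representation) or alternating (`(M, φ)` is a symplectic representation).
[cite: LooijengaLunts1997, §1 (1.3) p0005 L9–L12] -/
theorem IsLefschetzModule.isSymm_or_isAlt_of_isIrreducible [IsAlgClosed K] (A : IsLefschetzModule K h 𝔞)
    [Nontrivial M] [LieModule.IsIrreducible K (lefschetzLieAlgebra K h 𝔞) M] (hB : B ≠ 0) (hh : B.IsSkewAdjoint h)
    (h𝔞 : ∀ a ∈ 𝔞, B.IsSkewAdjoint a) : B.Nondegenerate ∧ (B.IsSymm ∨ LinearMap.IsAlt B) := by
  refine ⟨A.nondegenerate_of_isIrreducible hB hh h𝔞, ?_⟩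
  rcases A.flip_eq_or_flip_eq_neg_of_isIrreducible hB hh h𝔞 with h1 | h1
  · left
    rw [LinearMap.BilinForm.isSymm_def]
    intro x y
    have h2 := LinearMap.congr_fun₂ h1 y x
    rw [LinearMap.flip_apply] at h2
    exact h2
  · right
    intro x
    have h2 := LinearMap.congr_fun₂ h1 x x
    rw [LinearMap.flip_apply, LinearMap.neg_apply, LinearMap.neg_apply] at h2
    -- `φ(x, x) = -φ(x, x)` in characteristic `0`
    have h3 : (2 : K) * B x x = 0 := by linear_combination h2
    simpa using h3

/-- The same dichotomy with the printed hypothesis "`φ` is zero on `M_k × M_l` unless `k + l = 0`" in place of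
`φ.IsSkewAdjoint h`. [cite: LooijengaLunts1997, §1 (1.3) p0005 L3–L4, L9–L12] -/
theorem IsLefschetzModule.isSymm_or_isAlt_of_isIrreducible' [IsAlgClosed K] (A : IsLefschetzModule K h 𝔞)
    [Nontrivial M] [LieModule.IsIrreducible K (lefschetzLieAlgebra K h 𝔞) M] (hB : B ≠ 0)
    (h0 : ∀ k l : ℤ, k + l ≠ 0 → ∀ x ∈ degreeSpace h k, ∀ y ∈ degreeSpace h l, B x y = 0)
    (h𝔞 : ∀ a ∈ 𝔞, B.IsSkewAdjoint a) : B.Nondegenerate ∧ (B.IsSymm ∨ LinearMap.IsAlt B) :=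
  A.isSymm_or_isAlt_of_isIrreducible hB (isSkewAdjoint_of_forall_apply_eq_zero A.isZGrading h0) h𝔞

end Schur

end Literature.Algebra.Lie
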